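import Literature.Analysis.FluidPDE.Tao2016AveragedNS.SplitCascadeScaleOneSmall
import Literature.Analysis.FluidPDE.Tao2016AveragedNS.SplitCascadeRescaledWindow
import Literature.Analysis.FluidPDE.Tao2016AveragedNS.SplitCascadeRescaledRegime
import HarnessLib

/-!
# The split Prop. 6.5, Prop. 6.13, Ib: the fresh shell's `c`-asymmetry and the device `|c̃₁| + |Z̃_{c,1}|`

T. Tao, *Finite time blowup for an averaged three-dimensional Navier–Stokes equation*,
J. Amer. Math. Soc. 29 (2016), 601–674 (arXiv:1402.0290v3), §6.6 Prop. 6.13, (6.121)–(6.125).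
HONEST FRAMING: statements about the SPLIT cascade model system; nothing here proves the split
Prop. 6.5 and nothing here concerns the true Navier–Stokes equations.

In the split model the clock row (6.46♯) of the fresh shell reads
`∂ₜb̃₁ = (1+ε₀)^{5/2}(ε(ã₁² - Z̃²_{a,1}) - ε⁻¹K¹⁰(c̃₁² - Z̃²_{c,1})) + O(C₁(1+ε₀)^{2-n₀/2}Ẽ₁^{1/2})`, so the
Prop. 6.13 bootstrap (`TaoCascadeScaleOneBootstrap/Close/Regime.lean`) needs a level for the
`c`-asymmetry `Z̃_{c,1} = W 1 1` next to the one for `c̃₁ = Y 2 1`. The row (6.Z2♯)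
`∂ₜZ̃_{c,1} = -(1+ε₀)^{5/2}ε⁻¹K¹⁰ b̃₁ Z̃_{c,1} + O(…)` has NO source besides the error, so the same
Grönwall as (6.122) (`abs_c_one_le_exp_mul_integral`) bounds it, and — for hypotheses with error
constant `C₁/2`, the convention of `SplitCascadeRescaledWindow.lean` — the SUM `|c̃₁| + |Z̃_{c,1}|`
obeys EXACTLY Tao's bound (6.122) with the source
`R♯ = (1+ε₀)^{5/2}ε²e^{-K¹⁰}(ã₁² + Z̃²_{a,1}) + 4C₁(1+ε₀)^{-n₀/2}Ẽ₁^{1/2}` (`abs_c_one_add_absW_le`).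
With this device the clock source becomes
`R_b♯ = (1+ε₀)^{5/2}(ε(ã₁² + Z̃²_{a,1}) + ε⁻¹K¹⁰(|c̃₁| + |Z̃_{c,1}|)²) + 4C₁(1+ε₀)^{-n₀/2}Ẽ₁^{1/2}`
(`b_one_deriv_abs_le'`) and every constant of (6.123)–(6.125) stays Tao's. Also here: the `d̃₁` row
with the tree's exact right-hand side on the asymmetry window (`d_one_linear'`, using the sharp
master smallness `16ε⁻²ζ² ≤ (C₁/2)(1+ε₀)^{-n₀/2}`), and the one-sided (6.91) for `C₁/2`-hypotheses
(`c_one_ge_neg'`, which keeps the past `a`-asymmetry integral `∫(1+ε₀)^{5/2}ε²e^{-K¹⁰}Z̃²_{a,1}` —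
the one place where the split Prop. 6.5 needs more than energy control of the asymmetries).

## References

* T. Tao, arXiv:1402.0290v3, §6.6 Prop. 6.13, (6.91), (6.121)–(6.125). [`Tao2016AveragedNS`]
-/

noncomputable section

open Set MeasureTheory intervalIntegral Filter Topology
open Literature.Analysis.ODE

namespace Literature.Analysis.FluidPDE

namespace Tao2016AveragedNS

open TaoCascade

section ScaleOneAsym

variable {γ ε₀ K ε C₁ C₂ C₃ : ℝ} {n₀ N : ℤ} {ηp : ℤ → ℝ} {βp : ℕ → ℝ} {τ : ℤ → ℝ}
  {Xr : Fin 4 → ℤ → ℝ → ℝ} {W : Fin 3 → ℤ → ℝ → ℝ} {Er : ℤ → ℝ → ℝ} {T ζ : ℝ}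

/-- **(6.Z2♯) at `k = 1`** in the linear form `|Z̃'_{c,1} - β Z̃_{c,1}| ≤ 4C₁(1+ε₀)^{-n₀/2}Ẽ₁^{1/2}` with
`β = -(1+ε₀)^{5/2}ε⁻¹K¹⁰ b̃₁`. [cite: Tao2016AveragedNS, §6.6 (6.122)] -/
theorem RescaledSplitHypotheses.eqZ_c_one_delta
    (h : RescaledSplitHypotheses γ ε₀ K ε C₁ C₂ C₃ n₀ N ηp βp τ Xr W Er) (hε₀ : 0 < ε₀) (hε₀1 : ε₀ ≤ 1)
    (hC₁ : 0 ≤ C₁) {t : ℝ} (ht : τ (n₀ - N) ≤ t) :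
    |derivWithin (W 1 1) (Ici (τ (n₀ - N))) t -
        (-((1 + ε₀) ^ ((5 : ℝ) / 2) * ε⁻¹ * K ^ 10 * Xr 1 1 t)) * W 1 1 t| ≤
      4 * C₁ * (1 + ε₀) ^ (-(n₀ : ℝ) / 2) * Real.sqrt (Er 1 t) := by
  have he := h.eqZ_c_one ht
  have hid : derivWithin (W 1 1) (Ici (τ (n₀ - N))) t -
      (-((1 + ε₀) ^ ((5 : ℝ) / 2) * ε⁻¹ * K ^ 10 * Xr 1 1 t)) * W 1 1 t =
      derivWithin (W 1 1) (Ici (τ (n₀ - N))) t +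
        (1 + ε₀) ^ ((5 : ℝ) / 2) * (ε⁻¹ * K ^ 10 * Xr 1 1 t * W 1 1 t) := by ring
  rw [hid]
  exact he.trans (err_weight_one_le Er n₀ hε₀ hε₀1 hC₁ t)

/-- **The `c`-asymmetry of the fresh shell under control of the rotor phase**: with
`Λ(t) = ∫_{τ₀}^t |b̃₁| ≤ ε/100` on `[τ₀, T]`,
`|Z̃_{c,1}(t)| ≤ e^{(6/100)K^{10}} ∫_{τ₀}^t 4C₁(1+ε₀)^{-n₀/2}Ẽ₁^{1/2}` for `τ₀ ≤ t ≤ T` (Grönwall on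
(6.Z2♯), `Z̃_{c,1}(τ₀) = 0`; no source besides the error). [cite: Tao2016AveragedNS, §6.6 Prop. 6.13 (6.122)] -/
theorem RescaledSplitHypotheses.absW_c_one_le_exp_mul_integral
    (h : RescaledSplitHypotheses γ ε₀ K ε C₁ C₂ C₃ n₀ N ηp βp τ Xr W Er) (hε₀ : 0 < ε₀) (hε₀1 : ε₀ < 1)
    (hε : 0 < ε) (hC₁ : 0 ≤ C₁) (hN : n₀ ≤ N) {T : ℝ}
    (hΛ : ∀ t ∈ Icc (τ (n₀ - N)) T, ∫ s in (τ (n₀ - N))..t, |Xr 1 1 s| ≤ ε / 100)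
    {t : ℝ} (ht : t ∈ Icc (τ (n₀ - N)) T) :
    |W 1 1 t| ≤ Real.exp (6 / 100 * K ^ 10) *
      ∫ s in (τ (n₀ - N))..t, 4 * C₁ * (1 + ε₀) ^ (-(n₀ : ℝ) / 2) * Real.sqrt (Er 1 s) := by
  have h0 : (0 : ℝ) < 1 + ε₀ := by linarith
  have hq6 : (1 + ε₀) ^ ((5 : ℝ) / 2) ≤ 6 := rpow_five_halves_le_six h0.le (by linarith)
  set β : ℝ → ℝ := fun s => -((1 + ε₀) ^ ((5 : ℝ) / 2) * ε⁻¹ * K ^ 10 * Xr 1 1 s) with hβ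
  set R : ℝ → ℝ := fun s => 4 * C₁ * (1 + ε₀) ^ (-(n₀ : ℝ) / 2) * Real.sqrt (Er 1 s) with hR
  have hβc : ContinuousOn β (Icc (τ (n₀ - N)) T) :=
    (continuousOn_const.mul (h.continuousOn_X 1 1 le_rfl)).neg
  have hRc : ContinuousOn R (Icc (τ (n₀ - N)) T) :=
    continuousOn_const.mul ((h.continuousOn_E 1 le_rfl).sqrt)
  have hR0 : ∀ s ∈ Icc (τ (n₀ - N)) T, 0 ≤ R s := fun s hs => by
    simp only [hR]; have := h0.le; positivity
  have hbound : ∀ s ∈ Ico (τ (n₀ - N)) T,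
      |derivWithin (W 1 1) (Ici (τ (n₀ - N))) s - β s * W 1 1 s| ≤ R s := fun s hs =>
    h.eqZ_c_one_delta hε₀ hε₀1.le hC₁ hs.1
  have hmain := abs_le_linearComparison (h.continuousOn_W 1 1 le_rfl)
    (fun s hs => h.hasDeriv_W 1 1 hs.1) hRc hR0 hβc hbound ht
  have hinit : W 1 1 (τ (n₀ - N)) = 0 := h.init_W 1 1 (by omega)
  rw [hinit, abs_zero, zero_add] at hmain
  have hexp : Real.exp (∫ s in (τ (n₀ - N))..t, |β s|) ≤ Real.exp (6 / 100 * K ^ 10) := by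
    apply Real.exp_le_exp.2
    have hI0 : ∫ s in (τ (n₀ - N))..t, |β s| =
        ∫ s in (τ (n₀ - N))..t, |(1 + ε₀) ^ ((5 : ℝ) / 2) * ε⁻¹ * K ^ 10 * Xr 1 1 s| := by
      apply intervalIntegral.integral_congr; intro s _; simp only [hβ, abs_neg]
    have hI : ∫ s in (τ (n₀ - N))..t, |(1 + ε₀) ^ ((5 : ℝ) / 2) * ε⁻¹ * K ^ 10 * Xr 1 1 s| =
        (1 + ε₀) ^ ((5 : ℝ) / 2) * ε⁻¹ * K ^ 10 * ∫ s in (τ (n₀ - N))..t, |Xr 1 1 s| :=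
      integral_abs_rate_eq K hε₀ hε (Xr 1 1) (τ (n₀ - N)) t
    rw [hI0, hI]
    have hΛt := hΛ t ht
    have hK10 : 0 ≤ K ^ 10 := by positivity
    calc (1 + ε₀) ^ ((5 : ℝ) / 2) * ε⁻¹ * K ^ 10 * ∫ s in (τ (n₀ - N))..t, |Xr 1 1 s|
        ≤ (1 + ε₀) ^ ((5 : ℝ) / 2) * ε⁻¹ * K ^ 10 * (ε / 100) :=
          mul_le_mul_of_nonneg_left hΛt (by positivity)
      _ = (1 + ε₀) ^ ((5 : ℝ) / 2) * K ^ 10 / 100 := by field_simp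
      _ ≤ 6 * K ^ 10 / 100 := by gcongr
      _ = 6 / 100 * K ^ 10 := by ring
  have hint0 : 0 ≤ ∫ s in (τ (n₀ - N))..t, R s :=
    integral_nonneg ht.1 fun s hs => hR0 s ⟨hs.1, hs.2.trans ht.2⟩
  exact hmain.trans (mul_le_mul_of_nonneg_right hexp hint0)

/-- **The device `|c̃₁| + |Z̃_{c,1}|`**: for hypotheses with error constant `C₁/2` and
`Λ ≤ ε/100` on `[τ₀, T]`, `|c̃₁(t)| + |Z̃_{c,1}(t)| ≤ e^{(6/100)K^{10}} ∫_{τ₀}^t R♯` with Tao's source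
`R♯ = (1+ε₀)^{5/2}ε²e^{-K^{10}}(ã₁² + Z̃²_{a,1}) + 4C₁(1+ε₀)^{-n₀/2}Ẽ₁^{1/2}` (the two Grönwall bounds
carry `2C₁` each). [cite: Tao2016AveragedNS, §6.6 Prop. 6.13 (6.122)] -/
theorem RescaledSplitHypotheses.abs_c_one_add_absW_le
    (h : RescaledSplitHypotheses γ ε₀ K ε (C₁ / 2) C₂ C₃ n₀ N ηp βp τ Xr W Er) (hε₀ : 0 < ε₀)
    (hε₀1 : ε₀ < 1) (hε : 0 < ε) (hC₁ : 0 ≤ C₁) (hN : n₀ ≤ N) {T : ℝ}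
    (hΛ : ∀ t ∈ Icc (τ (n₀ - N)) T, ∫ s in (τ (n₀ - N))..t, |Xr 1 1 s| ≤ ε / 100)
    {t : ℝ} (ht : t ∈ Icc (τ (n₀ - N)) T) :
    |Xr 2 1 t| + |W 1 1 t| ≤ Real.exp (6 / 100 * K ^ 10) *
      ∫ s in (τ (n₀ - N))..t, ((1 + ε₀) ^ ((5 : ℝ) / 2) * ε ^ 2 * Real.exp (-K ^ 10) *
          (Xr 0 1 s ^ 2 + W 0 1 s ^ 2) +
        4 * C₁ * (1 + ε₀) ^ (-(n₀ : ℝ) / 2) * Real.sqrt (Er 1 s)) := by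
  have hC' : 0 ≤ C₁ / 2 := by linarith
  have h1 := h.abs_c_one_le_exp_mul_integral hε₀ hε₀1 hε hC' hN hΛ ht
  have h2 := h.absW_c_one_le_exp_mul_integral hε₀ hε₀1 hε hC' hN hΛ ht
  have hτ : τ (n₀ - N) ≤ t := ht.1
  -- continuity / integrability of the three integrands on `[τ₀, t]`
  have hcS : ContinuousOn (fun s => (1 + ε₀) ^ ((5 : ℝ) / 2) * ε ^ 2 * Real.exp (-K ^ 10) *
      (Xr 0 1 s ^ 2 + W 0 1 s ^ 2)) (Icc (τ (n₀ - N)) t) :=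
    continuousOn_const.mul (((h.continuousOn_X 0 1 le_rfl).pow 2).add
      ((h.continuousOn_W 0 1 le_rfl).pow 2))
  have hcE : ContinuousOn (fun s => Real.sqrt (Er 1 s)) (Icc (τ (n₀ - N)) t) :=
    (h.continuousOn_E 1 le_rfl).sqrt
  have hi1 : IntervalIntegrable (fun s => (1 + ε₀) ^ ((5 : ℝ) / 2) * ε ^ 2 * Real.exp (-K ^ 10) *
      (Xr 0 1 s ^ 2 + W 0 1 s ^ 2) + 4 * (C₁ / 2) * (1 + ε₀) ^ (-(n₀ : ℝ) / 2) * Real.sqrt (Er 1 s))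
      volume (τ (n₀ - N)) t :=
    (hcS.add (continuousOn_const.mul hcE)).intervalIntegrable_of_Icc hτ
  have hi2 : IntervalIntegrable (fun s => 4 * (C₁ / 2) * (1 + ε₀) ^ (-(n₀ : ℝ) / 2) *
      Real.sqrt (Er 1 s)) volume (τ (n₀ - N)) t :=
    (continuousOn_const.mul hcE).intervalIntegrable_of_Icc hτ
  have hsum : (∫ s in (τ (n₀ - N))..t, ((1 + ε₀) ^ ((5 : ℝ) / 2) * ε ^ 2 * Real.exp (-K ^ 10) *
        (Xr 0 1 s ^ 2 + W 0 1 s ^ 2) + 4 * (C₁ / 2) * (1 + ε₀) ^ (-(n₀ : ℝ) / 2) * Real.sqrt (Er 1 s))) +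
      (∫ s in (τ (n₀ - N))..t, 4 * (C₁ / 2) * (1 + ε₀) ^ (-(n₀ : ℝ) / 2) * Real.sqrt (Er 1 s)) =
      ∫ s in (τ (n₀ - N))..t, ((1 + ε₀) ^ ((5 : ℝ) / 2) * ε ^ 2 * Real.exp (-K ^ 10) *
          (Xr 0 1 s ^ 2 + W 0 1 s ^ 2) +
        4 * C₁ * (1 + ε₀) ^ (-(n₀ : ℝ) / 2) * Real.sqrt (Er 1 s)) := by
    rw [← intervalIntegral.integral_add hi1 hi2]
    apply intervalIntegral.integral_congr; intro s _; simp only; ring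
  have hE0 : 0 ≤ Real.exp (6 / 100 * K ^ 10) := (Real.exp_pos _).le
  calc |Xr 2 1 t| + |W 1 1 t| ≤ Real.exp (6 / 100 * K ^ 10) *
        (∫ s in (τ (n₀ - N))..t, ((1 + ε₀) ^ ((5 : ℝ) / 2) * ε ^ 2 * Real.exp (-K ^ 10) *
          (Xr 0 1 s ^ 2 + W 0 1 s ^ 2) + 4 * (C₁ / 2) * (1 + ε₀) ^ (-(n₀ : ℝ) / 2) * Real.sqrt (Er 1 s))) +
        Real.exp (6 / 100 * K ^ 10) *
        (∫ s in (τ (n₀ - N))..t, 4 * (C₁ / 2) * (1 + ε₀) ^ (-(n₀ : ℝ) / 2) * Real.sqrt (Er 1 s)) :=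
        add_le_add h1 h2
    _ = _ := by rw [← mul_add, hsum]

/-- **(6.46♯) at `k = 1` for the bootstrap**, for hypotheses with error constant `C₁/2`:
`|∂ₜb̃₁| ≤ (1+ε₀)^{5/2}(ε(ã₁² + Z̃²_{a,1}) + ε⁻¹K^{10}(|c̃₁| + |Z̃_{c,1}|)²) + 4C₁(1+ε₀)^{-n₀/2}Ẽ₁^{1/2}`
(the source `R_b♯` of the clock). [cite: Tao2016AveragedNS, §6.6 Prop. 6.13 (6.123)] -/
theorem RescaledSplitHypotheses.b_one_deriv_abs_le'
    (h : RescaledSplitHypotheses γ ε₀ K ε (C₁ / 2) C₂ C₃ n₀ N ηp βp τ Xr W Er) (hε : 0 < ε)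
    (hε₀ : 0 < ε₀) (hε₀1 : ε₀ ≤ 1) (hC₁ : 0 ≤ C₁) {t : ℝ} (ht : τ (n₀ - N) ≤ t) :
    |derivWithin (Xr 1 1) (Ici (τ (n₀ - N))) t| ≤
      (1 + ε₀) ^ ((5 : ℝ) / 2) * (ε * (Xr 0 1 t ^ 2 + W 0 1 t ^ 2) +
          ε⁻¹ * K ^ 10 * (|Xr 2 1 t| + |W 1 1 t|) ^ 2) +
        4 * C₁ * (1 + ε₀) ^ (-(n₀ : ℝ) / 2) * Real.sqrt (Er 1 t) := by
  have h0 : (0 : ℝ) < 1 + ε₀ := by linarith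
  have h1 := h.b_one_deriv_abs_le hε (by linarith) ht
  have herr := err_weight_one_le Er n₀ hε₀ hε₀1 (by linarith : 0 ≤ C₁ / 2) t
  have hQ : 0 ≤ (1 + ε₀) ^ ((5 : ℝ) / 2) := Real.rpow_nonneg h0.le _
  have hsq : Xr 2 1 t ^ 2 + W 1 1 t ^ 2 ≤ (|Xr 2 1 t| + |W 1 1 t|) ^ 2 := by
    rw [← sq_abs (Xr 2 1 t), ← sq_abs (W 1 1 t)]
    nlinarith [abs_nonneg (Xr 2 1 t), abs_nonneg (W 1 1 t)]
  have hin : ε * Xr 0 1 t ^ 2 + ε⁻¹ * K ^ 10 * Xr 2 1 t ^ 2 + ε * W 0 1 t ^ 2 +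
      ε⁻¹ * K ^ 10 * W 1 1 t ^ 2 ≤
      ε * (Xr 0 1 t ^ 2 + W 0 1 t ^ 2) + ε⁻¹ * K ^ 10 * (|Xr 2 1 t| + |W 1 1 t|) ^ 2 := by
    have hk : 0 ≤ ε⁻¹ * K ^ 10 := by positivity
    nlinarith [mul_le_mul_of_nonneg_left hsq hk]
  have hmono := mul_le_mul_of_nonneg_left hin hQ
  have hδ : 0 ≤ (1 + ε₀) ^ (-(n₀ : ℝ) / 2) * Real.sqrt (Er 1 t) :=
    mul_nonneg (Real.rpow_nonneg h0.le _) (Real.sqrt_nonneg _)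
  have hw : 4 * (C₁ / 2) * (1 + ε₀) ^ (-(n₀ : ℝ) / 2) * Real.sqrt (Er 1 t) ≤
      4 * C₁ * (1 + ε₀) ^ (-(n₀ : ℝ) / 2) * Real.sqrt (Er 1 t) := by nlinarith
  linarith

/-- The continuity of the clock source `R_b♯`. [cite: Tao2016AveragedNS, §6.6 Prop. 6.13 (6.123)] -/
theorem RescaledSplitHypotheses.continuousOn_source_b_one'
    (h : RescaledSplitHypotheses γ ε₀ K ε C₁ C₂ C₃ n₀ N ηp βp τ Xr W Er) (C : ℝ) {a b : ℝ}
    (ha : τ (n₀ - N) ≤ a) :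
    ContinuousOn (fun s => (1 + ε₀) ^ ((5 : ℝ) / 2) * (ε * (Xr 0 1 s ^ 2 + W 0 1 s ^ 2) +
        ε⁻¹ * K ^ 10 * (|Xr 2 1 s| + |W 1 1 s|) ^ 2) +
      4 * C * (1 + ε₀) ^ (-(n₀ : ℝ) / 2) * Real.sqrt (Er 1 s)) (Icc a b) := by
  have hX := fun i => h.continuousOn_X i 1 ha (b := b)
  have hW := fun i => h.continuousOn_W i 1 ha (b := b)
  exact (continuousOn_const.mul ((continuousOn_const.mul (((hX 0).pow 2).add ((hW 0).pow 2))).add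
    (continuousOn_const.mul (((hX 2).abs.add (hW 1).abs).pow 2)))).add
    (continuousOn_const.mul (h.continuousOn_E 1 ha).sqrt)

/-- **(6.48) at `k = 1` in linear form with the tree's exact right-hand side on the window**:
for hypotheses with error constant `C₁/2` and a window certificate, on `[0, T]`, given `Ẽ₁ ≤ 1` and
`|c̃₁| ≤ B_c`: `|∂ₜd̃₁ - (-(1+ε₀)^5 K ã₂) d̃₁| ≤ (1+ε₀)^{5/2}ε⁻²B_c√2 + C₁(1+ε₀)^{2-n₀/2}` (the
asymmetry product `(1+ε₀)^{5/2}ε⁻²|Z̃_aZ̃_c| ≤ 6ε⁻²ζ²` is paid from the half error constant via the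
master smallness `16ε⁻²ζ² ≤ (C₁/2)(1+ε₀)^{-n₀/2}`). [cite: Tao2016AveragedNS, §6.6 Prop. 6.13 (6.125)] -/
theorem RescaledSplitHypotheses.d_one_linear'
    (h : RescaledSplitHypotheses γ ε₀ K ε (C₁ / 2) C₂ C₃ n₀ N ηp βp τ Xr W Er)
    (hw : AsymWindow ε₀ K ε C₁ n₀ W T ζ) (hτ0 : τ (n₀ - N) ≤ 0) (hε : 0 < ε) (hε₀ : 0 < ε₀)
    (hε₀1 : ε₀ < 1) (hK1 : 1 ≤ K) (hC₁ : 0 ≤ C₁) {t Bc : ℝ} (ht : t ∈ Icc 0 T) (hE1 : Er 1 t ≤ 1)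
    (hc : |Xr 2 1 t| ≤ Bc) :
    |derivWithin (Xr 3 1) (Ici (τ (n₀ - N))) t -
        (-((1 + ε₀) ^ ((5 : ℝ) / 2) * (1 + ε₀) ^ ((5 : ℝ) / 2) * K * Xr 0 2 t)) * Xr 3 1 t| ≤
      (1 + ε₀) ^ ((5 : ℝ) / 2) * (ε ^ 2)⁻¹ * Bc * Real.sqrt 2 +
        C₁ * (1 + ε₀) ^ (2 - (n₀ : ℝ) / 2) := by
  have h0 : (0 : ℝ) < 1 + ε₀ := by linarith
  have hWt := hw.asym t ht
  have h1 := h.d_one_linear (by linarith) (by linarith : 0 ≤ C₁ / 2) (hτ0.trans ht.1) hE1 hc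
    (hWt 0).2.2 (hWt 1).2.2
  have hq6 : (1 + ε₀) ^ ((5 : ℝ) / 2) ≤ 6 := rpow_five_halves_le_six h0.le (by linarith)
  have hz : 0 ≤ (ε ^ 2)⁻¹ * ζ ^ 2 := by positivity
  have hq2 : (1 : ℝ) ≤ (1 + ε₀) ^ (2 : ℝ) := Real.one_le_rpow (by linarith) (by norm_num)
  have hK5 : (1 : ℝ) ≤ K ^ 5 := one_le_pow₀ hK1
  have hL : (1 : ℝ) ≤ K ^ 5 * (1 + ε₀) ^ (2 : ℝ) := one_le_mul_of_one_le_of_one_le hK5 hq2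
  have hρ0 : 0 ≤ (1 + ε₀) ^ (-(n₀ : ℝ) / 2) := Real.rpow_nonneg h0.le _
  have hK0 : 0 ≤ K := by linarith
  -- from the master smallness: `16 ε⁻² ζ² ≤ (C₁/2) (1+ε₀)^{-n₀/2}`
  have h16 : 16 * ((ε ^ 2)⁻¹ * ζ ^ 2) ≤ C₁ / 2 * (1 + ε₀) ^ (-(n₀ : ℝ) / 2) := by
    have hm := hw.small
    have e : 16 * (K ^ 5 * (1 + ε₀) ^ (2 : ℝ)) * ((ε ^ 2)⁻¹ + ε⁻¹ * K ^ 10 + K + 1) * ζ ^ 2 =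
        (K ^ 5 * (1 + ε₀) ^ (2 : ℝ)) * (16 * ((ε ^ 2)⁻¹ * ζ ^ 2)) +
        16 * (K ^ 5 * (1 + ε₀) ^ (2 : ℝ)) * ((ε⁻¹ * K ^ 10 + K + 1) * ζ ^ 2) := by ring
    have a1 : 1 * (16 * ((ε ^ 2)⁻¹ * ζ ^ 2)) ≤
        (K ^ 5 * (1 + ε₀) ^ (2 : ℝ)) * (16 * ((ε ^ 2)⁻¹ * ζ ^ 2)) :=
      mul_le_mul_of_nonneg_right hL (by positivity)
    have a2 : 0 ≤ 16 * (K ^ 5 * (1 + ε₀) ^ (2 : ℝ)) * ((ε⁻¹ * K ^ 10 + K + 1) * ζ ^ 2) := by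
      positivity
    linarith
  have hsplit : (1 + ε₀) ^ (2 - (n₀ : ℝ) / 2) = (1 + ε₀) ^ (2 : ℝ) * (1 + ε₀) ^ (-(n₀ : ℝ) / 2) := by
    rw [← Real.rpow_add h0]; congr 1; ring
  have hkey : (1 + ε₀) ^ ((5 : ℝ) / 2) * (ε ^ 2)⁻¹ * ζ ^ 2 ≤ C₁ / 2 * (1 + ε₀) ^ (2 - (n₀ : ℝ) / 2) := by
    rw [hsplit]
    have b1 : (1 + ε₀) ^ ((5 : ℝ) / 2) * (ε ^ 2)⁻¹ * ζ ^ 2 ≤ 6 * ((ε ^ 2)⁻¹ * ζ ^ 2) := by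
      rw [mul_assoc]; exact mul_le_mul_of_nonneg_right hq6 hz
    have hC : 0 ≤ C₁ / 2 := by linarith
    have b2 : C₁ / 2 * (1 * (1 + ε₀) ^ (-(n₀ : ℝ) / 2)) ≤
        C₁ / 2 * ((1 + ε₀) ^ (2 : ℝ) * (1 + ε₀) ^ (-(n₀ : ℝ) / 2)) :=
      mul_le_mul_of_nonneg_left (mul_le_mul_of_nonneg_right hq2 hρ0) hC
    rw [one_mul] at b2
    linarith
  have hC2 : C₁ / 2 * (1 + ε₀) ^ (2 - (n₀ : ℝ) / 2) + C₁ / 2 * (1 + ε₀) ^ (2 - (n₀ : ℝ) / 2) =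
      C₁ * (1 + ε₀) ^ (2 - (n₀ : ℝ) / 2) := by ring
  linarith

/-- **(6.91) for hypotheses with error constant `C₁/2`** (the one-sided bound on `c̃₁`, keeping the
negative part `-(1+ε₀)^{5/2}ε²e^{-K¹⁰}Z̃²_{a,1}` of the split seed in the source): with `Λ ≤ ε/100` on
`[τ₀, T]`, for `τ₀ ≤ t ≤ T`,
`c̃₁(t) ≥ -e^{(6/100)K^{10}} ∫_{τ₀}^t (4C₁(1+ε₀)^{-n₀/2}Ẽ₁^{1/2} + (1+ε₀)^{5/2}ε²e^{-K^{10}}Z̃²_{a,1})`.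
[cite: Tao2016AveragedNS, §6.5 (6.91)] -/
theorem RescaledSplitHypotheses.c_one_ge_neg'
    (h : RescaledSplitHypotheses γ ε₀ K ε (C₁ / 2) C₂ C₃ n₀ N ηp βp τ Xr W Er) (hε₀ : 0 < ε₀)
    (hε₀1 : ε₀ < 1) (hε : 0 < ε) (hC₁ : 0 ≤ C₁) (hN : n₀ ≤ N) {T : ℝ}
    (hΛ : ∀ t ∈ Icc (τ (n₀ - N)) T, ∫ s in (τ (n₀ - N))..t, |Xr 1 1 s| ≤ ε / 100)
    {t : ℝ} (ht : t ∈ Icc (τ (n₀ - N)) T) :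
    -(Real.exp (6 / 100 * K ^ 10) *
      ∫ s in (τ (n₀ - N))..t, (4 * C₁ * (1 + ε₀) ^ (-(n₀ : ℝ) / 2) * Real.sqrt (Er 1 s) +
        (1 + ε₀) ^ ((5 : ℝ) / 2) * ε ^ 2 * Real.exp (-K ^ 10) * W 0 1 s ^ 2)) ≤ Xr 2 1 t := by
  have h0 : (0 : ℝ) < 1 + ε₀ := by linarith
  have h1 := h.c_one_ge_neg hε₀ hε₀1 hε (by linarith : 0 ≤ C₁ / 2) hN hΛ ht
  have hτ : τ (n₀ - N) ≤ t := ht.1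
  have hcE : ContinuousOn (fun s => Real.sqrt (Er 1 s)) (Icc (τ (n₀ - N)) t) :=
    (h.continuousOn_E 1 le_rfl).sqrt
  have hcW : ContinuousOn (fun s => (1 + ε₀) ^ ((5 : ℝ) / 2) * ε ^ 2 * Real.exp (-K ^ 10) *
      W 0 1 s ^ 2) (Icc (τ (n₀ - N)) t) :=
    continuousOn_const.mul ((h.continuousOn_W 0 1 le_rfl).pow 2)
  have hi1 : IntervalIntegrable (fun s => 4 * (C₁ / 2) * (1 + ε₀) ^ (-(n₀ : ℝ) / 2) *
      Real.sqrt (Er 1 s) + (1 + ε₀) ^ ((5 : ℝ) / 2) * ε ^ 2 * Real.exp (-K ^ 10) * W 0 1 s ^ 2)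
      volume (τ (n₀ - N)) t :=
    ((continuousOn_const.mul hcE).add hcW).intervalIntegrable_of_Icc hτ
  have hi2 : IntervalIntegrable (fun s => 4 * C₁ * (1 + ε₀) ^ (-(n₀ : ℝ) / 2) *
      Real.sqrt (Er 1 s) + (1 + ε₀) ^ ((5 : ℝ) / 2) * ε ^ 2 * Real.exp (-K ^ 10) * W 0 1 s ^ 2)
      volume (τ (n₀ - N)) t :=
    ((continuousOn_const.mul hcE).add hcW).intervalIntegrable_of_Icc hτ
  have hmono : (∫ s in (τ (n₀ - N))..t, (4 * (C₁ / 2) * (1 + ε₀) ^ (-(n₀ : ℝ) / 2) *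
      Real.sqrt (Er 1 s) + (1 + ε₀) ^ ((5 : ℝ) / 2) * ε ^ 2 * Real.exp (-K ^ 10) * W 0 1 s ^ 2)) ≤
      ∫ s in (τ (n₀ - N))..t, (4 * C₁ * (1 + ε₀) ^ (-(n₀ : ℝ) / 2) * Real.sqrt (Er 1 s) +
        (1 + ε₀) ^ ((5 : ℝ) / 2) * ε ^ 2 * Real.exp (-K ^ 10) * W 0 1 s ^ 2) := by
    refine intervalIntegral.integral_mono_on hτ hi1 hi2 fun s _ => ?_
    have hδ : 0 ≤ (1 + ε₀) ^ (-(n₀ : ℝ) / 2) * Real.sqrt (Er 1 s) :=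
      mul_nonneg (Real.rpow_nonneg h0.le _) (Real.sqrt_nonneg _)
    nlinarith
  have hE0 : 0 ≤ Real.exp (6 / 100 * K ^ 10) := (Real.exp_pos _).le
  have := mul_le_mul_of_nonneg_left hmono hE0
  linarith

end ScaleOneAsym

end Tao2016AveragedNS

end Literature.Analysis.FluidPDE
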